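import Summits.CriticalPhenomena.SAWScalingLimit.Theorems.SAWDevelopingMapObservableToSLETypeLadderCarvedReductionCore
import Summits.CriticalPhenomena.SAWScalingLimit.Theorems.SAWDefectDecoherenceObservableToSLERNestedGateDefs
import Summits.CriticalPhenomena.SAWScalingLimit.Theorems.SAWDefectDecoherenceObservableToSLERNestedLinkDefs
import Summits.CriticalPhenomena.SAWScalingLimit.Theorems.ObservableToSLE.Negative.Identification
import HarnessLib

/-!
# Crux `SAWDevelopingMap.ObservableToSLE` (stmt-CriticalPhenomena-10472), line `six-class-type-ladder`,
stub T2b `stub_carvedReduction` (= twin stub 5a4 of stmt-CriticalPhenomena-14005): THE ASSEMBLY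
`MovingCarvingSqueeze → TwoPieceAdmIdentification → SLELawContinuity → CarvedSeqIdentificationPM FatAnchoredClassZero`

Landing target:
`Summits/CriticalPhenomena/SAWScalingLimit/Theorems/SAWDevelopingMapObservableToSLETypeLadderCarvedReductionAssembly.lean`
(`--supports stmt-CriticalPhenomena-10472`; registered sub-goal `stub_carvedReduction_continuityStep`).

T2b is `TwoPieceAdmRestrictionLimit → TwoPieceAdmIdentification → SLELawContinuity →
CarvedSeqIdentificationPM FatAnchoredClassZero`.  `stub_carvedReduction_assembly` proves it with
the first hypothesis REPLACED by the geometric–analytic package it is needed for, the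
MOVING-CARVING SQUEEZE (items (G1)–(G7) of the twin's audit): for every closeness level `η` a
locality radius `R₀` such that, along every sequence of fat class-zero tame carvings with realised
gates and every subsequence, a further subsequence admits ONE fixed two-piece flat Dobrushin
domain `M`, `η`-close to `D` after translating back by `τ`, with an admissible lattice family
`Λ'` (the hypotheses of T2a verbatim), lattice translations `x_j` (`δ_j·triEmbed x_j → τ`)
carrying `Λ'(δ_j)` onto a sub-family cell `Λ''_j` of the `j`-th carved law (no bad edge, gates
matching) of carved mass `≥ 1 − ε'` eventually.  T2b is thus reduced to the single piece
`TwoPieceAdmRestrictionLimit → MovingCarvingSqueeze` (file `…CarvedReductionOfSqueeze`).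
Proof ((G0), (G8), (G9)): contradiction along a bad subsequence; squeeze package at level
`ε' = min(1/2, ε/(16(‖f‖+1)))`; the pinned DCS laws of `(Λ'(δ_j); a', b')` are eventually
probability, TIGHT and carry a UNIFORM MODULUS, and the carved `f`-integrals are `2‖f‖ε'`-close
to their translated integrals (`core_transport`, `core_transport_event`); every weak subsequential
limit is SLE(8/3) in `M` by T2a, its translate is SLE(8/3) in `M + τ`, `ε/2`-close to `ν` by
`SLELawContinuity` (`stub_carvedReduction_continuityStep`); `exists_close_of_weakLimits`
(Prokhorov + Slutsky) gives a good index on the bad subsequence.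
-/

noncomputable section
noncomputable section

open scoped BigOperators Topology NNReal ENNReal Classical BoundedContinuousFunction
open Filter Set MeasureTheory Metric
open Literature.Probability.LatticeModels (HexVertex hexGraph hexCenter triZeta triEmbed Site polyline)
open Literature.Probability.RandomPlanarGeometry
open Literature.Probability.RandomPlanarGeometry.SAW
open UpperHalfPlane (upperHalfPlaneSet)

namespace Summit.CriticalPhenomena.SAWScalingLimit.Theorems.ObservableToSLE.TypeLadder

open Summit.CriticalPhenomena.SAWScalingLimit.Theorems.ObservableToSLER.BridgeGate
open Summit.CriticalPhenomena.SAWScalingLimit.Theorems.ObservableToSLER.NestedGate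
open Summit.CriticalPhenomena.SAWScalingLimit.Theorems.ObservableToSLER.TwoPiece
  (dcsMass_pos integral_dcsLaw dcsLaw_apply isProbabilityMeasure_dcsLaw)
open Summit.CriticalPhenomena.SAWScalingLimit.Theorems.ObservableToSLE.Negative (finite_hexDomainSAW)

/-- Translating by `0` is the identity on curve classes. -/
theorem translate_zero (c : CurveClass ℂ) :
    CurveClass.map ⟨Homeomorph.addRight (0 : ℂ), (Homeomorph.addRight (0 : ℂ)).continuous⟩ c = c := by
  obtain ⟨γ, rfl⟩ := CurveClass.surjective_mk c
  exact congrArg CurveClass.mk (Curve.ext (ContinuousMap.ext fun t => add_zero _))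

/-- `ENNReal` bookkeeping of the squeeze: `P(bad) ≤ η(1 − ε')` and `1 − ε' ≤ P(A)` give
`P(bad) ≤ η · P(A)`. -/
theorem le_mul_of_squeeze {p pa : ℝ≥0∞} {η ε' : ℝ} (hη : 0 ≤ η) (hpa : pa ≠ ∞)
    (hp : p ≤ ENNReal.ofReal (η * (1 - ε'))) (hsq : 1 - ε' ≤ pa.toReal) :
    p ≤ ENNReal.ofReal η * pa :=
  hp.trans (le_of_eq_of_le (ENNReal.ofReal_mul hη)
    (mul_le_mul_right ((ENNReal.ofReal_le_iff_le_toReal hpa).2 hsq) _))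

/-- **Registered sub-goal `stub_carvedReduction_continuityStep`** (piece (G9), TRANSLATION
COVARIANCE + RADÓ CONTINUITY): if `M + τ` is `η`-close to `D` (boundary parametrisations and marked
points) at a continuity level `η` of the SLE(8/3) law of `D` for `(f, ε)`, then for every SLE(8/3)
law `μ` of `M` and `ν` of `D`, `|∫ f(c + τ) dμ(c) − ∫ f dν| ≤ ε`. -/
theorem stub_carvedReduction_continuityStep :
    ∀ (D M : DobrushinDomain) (τ : ℂ) (η ε : ℝ) (f : CurveClass ℂ →ᵇ ℝ)
      (μ ν : Measure (CurveClass ℂ)),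
      (∀ (M' : DobrushinDomain), (∀ t : ℝ, dist (M'.boundary t) (D.boundary t) ≤ η) →
        dist (M'.pt 0) (D.pt 0) ≤ η → dist (M'.pt 1) (D.pt 1) ≤ η →
        ∀ μ' ν' : Measure (CurveClass ℂ), IsSLELaw ((8 : ℝ≥0) / 3) M' μ' →
          IsSLELaw ((8 : ℝ≥0) / 3) D ν' → |∫ x, f x ∂μ' - ∫ x, f x ∂ν'| ≤ ε) →
      (∀ t : ℝ, dist (M.boundary t + τ) (D.boundary t) ≤ η) →
      dist (M.pt 0 + τ) (D.pt 0) ≤ η → dist (M.pt 1 + τ) (D.pt 1) ≤ η →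
      IsSLELaw ((8 : ℝ≥0) / 3) M μ → IsSLELaw ((8 : ℝ≥0) / 3) D ν →
      |(∫ c, f (CurveClass.map ⟨Homeomorph.addRight τ, (Homeomorph.addRight τ).continuous⟩ c) ∂μ) -
        ∫ x, f x ∂ν| ≤ ε := by
  intro D M τ η ε f μ ν hcont hbd hpt0 hpt1 hμ hν
  have h := hcont (M.map (Homeomorph.addRight τ)) (fun t => hbd t) hpt0 hpt1 _ ν
    (isSLELaw_translate τ hμ) hν
  rwa [integral_map_curveClassMap] at h

/-- **THE ASSEMBLY `stub_carvedReduction_assembly`** (crux item stmt-CriticalPhenomena-10472, stub T2b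
`stub_carvedReduction`): `MovingCarvingSqueeze → TwoPieceAdmIdentification → SLELawContinuity →
CarvedSeqIdentificationPM FatAnchoredClassZero` (all inlined; the statement exceeds the `stub-add`
size limit — to be registered through the line skeleton by the lead). -/
theorem stub_carvedReduction_assembly :
    (    ∀ (D : DobrushinDomain) (a b : ℝ → HexVertex), IsEmbEndpointApprox hexGraph hexCenter D a b →
      ∀ η > (0 : ℝ), ∃ R₀ > (0 : ℝ), ∀ R ∈ Set.Ioc (0 : ℝ) R₀, ∀ ρ > (0 : ℝ), ∀ N : ℕ,
          ∀ (δ : ℕ → ℝ) (S T : ℕ → ℕ → Set HexVertex) (n n' : ℕ → ℕ) (q q' : ℕ → HexVertex),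
            Tendsto δ atTop (𝓝[>] 0) →
            (∀ k, TameNestedFamily (δ k) R N (a (δ k)) (S k) ∧
              TameNestedFamily (δ k) R N (b (δ k)) (T k) ∧
              (((∀ i, ExteriorAnchored D.carrier (δ k) (S k i) (a (δ k))) ∧
          (∀ i, ExteriorAnchored D.carrier (δ k) (T k i) (b (δ k))) ∧
          (∀ (i : ℕ) (p q : HexVertex), HasCleanWindow D.carrier (δ k) ρ (S k i) p q →
            rowOf 0 q = rowOf 0 p + 1 ∧
              ∀ x : HexVertex, ((δ k : ℝ) : ℂ) * hexCenter x ∈ ball (((δ k : ℝ) : ℂ) * hexCenter q) ρ →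
                (x ∈ S k i ↔ rowOf 0 x ≤ rowOf 0 p)) ∧
          (∀ (i : ℕ) (p q : HexVertex), HasCleanWindow D.carrier (δ k) ρ (T k i) p q →
            rowOf 0 q = rowOf 0 p + 1 ∧
              ∀ x : HexVertex, ((δ k : ℝ) : ℂ) * hexCenter x ∈ ball (((δ k : ℝ) : ℂ) * hexCenter q) ρ →
                (x ∈ T k i ↔ rowOf 0 x ≤ rowOf 0 p))) ∧
          (∀ (i : ℕ) (p q : HexVertex), HasCleanWindow D.carrier (δ k) ρ (S k i) p q →
            ∃ K : Set ℂ, IsCompact K ∧ IsConnected K ∧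
              ((δ k : ℝ) : ℂ) * hexCenter q - ((ρ / 2 : ℝ) : ℂ) * Complex.I ∈ K ∧ ((δ k : ℝ) : ℂ) * hexCenter (a (δ k)) ∈ K ∧
              ∀ v : HexVertex, Metric.infDist (((δ k : ℝ) : ℂ) * hexCenter v) K ≤ ρ / 4 → v ∈ S k i) ∧
          (∀ (i : ℕ) (p q : HexVertex), HasCleanWindow D.carrier (δ k) ρ (T k i) p q →
            ∃ K : Set ℂ, IsCompact K ∧ IsConnected K ∧
              ((δ k : ℝ) : ℂ) * hexCenter q - ((ρ / 2 : ℝ) : ℂ) * Complex.I ∈ K ∧ ((δ k : ℝ) : ℂ) * hexCenter (b (δ k)) ∈ K ∧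
              ∀ v : HexVertex, Metric.infDist (((δ k : ℝ) : ℂ) * hexCenter v) K ≤ ρ / 4 → v ∈ T k i))) →
            (∀ k, ∃ (γ : HexDomainSAW D.carrier (δ k) (a (δ k)) (b (δ k))) (m : ℕ) (p : HexVertex)
                (m' : ℕ) (p' : HexVertex),
              IsFirstGoodGateN D.carrier (δ k) ρ R (S k) (a (δ k)) γ.walk.support (n k) m p (q k) ∧
              IsFirstGoodGateN D.carrier (δ k) ρ R (T k) (b (δ k)) γ.walk.support.reverse
                (n' k) m' p' (q' k) ∧
              WideLink D.carrier (δ k) ρ (S k (n k) ∪ T k (n' k)) (q k) (q' k)) →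
            ∀ ε' > (0 : ℝ), ∀ φ : ℕ → ℕ, StrictMono φ →
              ∃ (ψ : ℕ → ℕ) (M : DobrushinDomain) (τ : ℂ) (ρ' : ℝ) (Λ' : ℝ → Finset HexVertex)
                (m : Fin 2 → ℝ → ℤ) (a' b' : ℝ → Sym2 HexVertex) (x : ℕ → Site 2)
                (Λ'' : ℕ → Finset HexVertex) (pu pv : ℕ → HexVertex),
                StrictMono ψ ∧
                (∀ t : ℝ, dist (M.boundary t + τ) (D.boundary t) ≤ η) ∧
                dist (M.pt 0 + τ) (D.pt 0) ≤ η ∧ dist (M.pt 1 + τ) (D.pt 1) ≤ η ∧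
                (0 < ρ' ∧ ∀ i : Fin 2,
                  M.carrier ∩ ball (M.pt i) ρ' = {z : ℂ | (M.pt i).im < z.im} ∩ ball (M.pt i) ρ') ∧
                (∀ᶠ δ' : ℝ in 𝓝[>] 0, hexDomainSimplyConnected (Λ' δ') ∧
                  a' δ' ∈ hexDomainBoundary (Λ' δ') ∧ b' δ' ∈ hexDomainBoundary (Λ' δ') ∧
                  Nonempty (HexMidEdgeSAW (Λ' δ') (a' δ') (b' δ')) ∧
                  (hexGraph.induce (↑(Λ' δ') : Set HexVertex)).Preconnected ∧
                  (∀ v ∈ Λ' δ', (δ' : ℂ) * hexCenter v ∈ M.carrier) ∧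
                  (∀ i : Fin 2, ∀ v : HexVertex, (δ' : ℂ) * hexCenter v ∈ ball (M.pt i) ρ' →
                    (v ∈ Λ' δ' ↔ m i δ' ≤ v.1 1))) ∧
                (∀ K : Set ℂ, IsCompact K → K ⊆ M.carrier →
                  ∀ᶠ δ' : ℝ in 𝓝[>] 0, ∀ v : HexVertex, (δ' : ℂ) * hexCenter v ∈ K → v ∈ Λ' δ') ∧
                Tendsto (fun δ' : ℝ => (δ' : ℂ) * hexMidpoint (a' δ')) (𝓝[>] 0) (𝓝 (M.pt 0)) ∧
                Tendsto (fun δ' : ℝ => (δ' : ℂ) * hexMidpoint (b' δ')) (𝓝[>] 0) (𝓝 (M.pt 1)) ∧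
                Tendsto (fun j : ℕ => ((δ (φ (ψ j)) : ℝ) : ℂ) *
                  Literature.Probability.LatticeModels.triEmbed (x j)) atTop (𝓝 τ) ∧
                (∀ j : ℕ,
                  (∀ w : HexVertex, w ∈ Λ'' j ↔ ((-(x j) + w.1, w.2) : HexVertex) ∈ Λ' (δ (φ (ψ j)))) ∧
                  (∀ w ∈ Λ'' j, w ∉ S (φ (ψ j)) (n (φ (ψ j))) ∪ T (φ (ψ j)) (n' (φ (ψ j)))) ∧
                  (∀ w ∈ Λ'' j, ∀ y ∈ Λ'' j, hexGraph.Adj w y →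
                    (hexDomainGraph D.carrier (δ (φ (ψ j)))).Adj w y) ∧
                  q (φ (ψ j)) ∈ Λ'' j ∧
                  pu j ∈ S (φ (ψ j)) (n (φ (ψ j))) ∪ T (φ (ψ j)) (n' (φ (ψ j))) ∧
                  pv j ∈ S (φ (ψ j)) (n (φ (ψ j))) ∪ T (φ (ψ j)) (n' (φ (ψ j))) ∧
                  hexGraph.Adj (q (φ (ψ j))) (pu j) ∧
                  s(q (φ (ψ j)), pu j) ≠ s(q' (φ (ψ j)), pv j) ∧
                  (a' (δ (φ (ψ j)))).map (fun w : HexVertex => ((x j + w.1, w.2) : HexVertex)) =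
                    s(q (φ (ψ j)), pu j) ∧
                  (b' (δ (φ (ψ j)))).map (fun w : HexVertex => ((x j + w.1, w.2) : HexVertex)) =
                    s(q' (φ (ψ j)), pv j)) ∧
                (∀ᶠ j : ℕ in atTop, 1 - ε' ≤
                  (carvedLaw D.carrier (δ (φ (ψ j))) (S (φ (ψ j)) (n (φ (ψ j))) ∪ T (φ (ψ j)) (n' (φ (ψ j))))
                    (q (φ (ψ j))) (q' (φ (ψ j))) {ξ | ∀ w ∈ ξ.walk.support, w ∈ Λ'' j}).toReal)) →
    (∀ (M : DobrushinDomain) (ρ : ℝ) (Λ : ℝ → Finset HexVertex) (m : Fin 2 → ℝ → ℤ)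
      (a b : ℝ → Sym2 HexVertex),
      (0 < ρ ∧ ∀ i : Fin 2, M.carrier ∩ ball (M.pt i) ρ = {z : ℂ | (M.pt i).im < z.im} ∩ ball (M.pt i) ρ) →
      (∀ᶠ δ : ℝ in 𝓝[>] 0, hexDomainSimplyConnected (Λ δ) ∧ a δ ∈ hexDomainBoundary (Λ δ) ∧
        b δ ∈ hexDomainBoundary (Λ δ) ∧ Nonempty (HexMidEdgeSAW (Λ δ) (a δ) (b δ)) ∧
        (hexGraph.induce (↑(Λ δ) : Set HexVertex)).Preconnected ∧
        (∀ v ∈ Λ δ, (δ : ℂ) * hexCenter v ∈ M.carrier) ∧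
        (∀ i : Fin 2, ∀ v : HexVertex, (δ : ℂ) * hexCenter v ∈ ball (M.pt i) ρ →
          (v ∈ Λ δ ↔ m i δ ≤ v.1 1))) →
      (∀ K : Set ℂ, IsCompact K → K ⊆ M.carrier →
        ∀ᶠ δ : ℝ in 𝓝[>] 0, ∀ v : HexVertex, (δ : ℂ) * hexCenter v ∈ K → v ∈ Λ δ) →
      Tendsto (fun δ : ℝ => (δ : ℂ) * hexMidpoint (a δ)) (𝓝[>] 0) (𝓝 (M.pt 0)) →
      Tendsto (fun δ : ℝ => (δ : ℂ) * hexMidpoint (b δ)) (𝓝[>] 0) (𝓝 (M.pt 1)) →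
      ∀ (μ : Measure (CurveClass ℂ)) (s : ℕ → ℝ), IsProbabilityMeasure μ →
        Tendsto s atTop (𝓝[>] 0) →
        (∀ f : CurveClass ℂ →ᵇ ℝ,
          Tendsto (fun n =>
            (∑ γ : HexMidEdgeSAW (Λ (s n)) (a (s n)) (b (s n)),
                hexCriticalFugacity ^ γ.length *
                  f (CurveClass.mk ⟨polyline (γ.verts.map fun v => ((s n : ℝ) : ℂ) * hexCenter v)⟩)) /
              (∑ γ : HexMidEdgeSAW (Λ (s n)) (a (s n)) (b (s n)), hexCriticalFugacity ^ γ.length))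
            atTop (𝓝 (∫ x, f x ∂μ))) →
        (∀ ε η : ℝ, 0 < ε → 0 < η → ∃ θ : ℝ, 0 < θ ∧ ∀ᶠ n in atTop,
          (∑ γ : HexMidEdgeSAW (Λ (s n)) (a (s n)) (b (s n)),
              if CurveClass.mk ⟨polyline (γ.verts.map fun v => ((s n : ℝ) : ℂ) * hexCenter v)⟩ ∉
                  CurveClass.modulusClass ε θ
              then hexCriticalFugacity ^ γ.length else 0) ≤
            η * ∑ γ : HexMidEdgeSAW (Λ (s n)) (a (s n)) (b (s n)), hexCriticalFugacity ^ γ.length) →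
        IsSLELaw ((8 : ℝ≥0) / 3) M μ) →
    (∀ (D : DobrushinDomain) (f : CurveClass ℂ →ᵇ ℝ) (ε : ℝ), 0 < ε → ∃ η > (0 : ℝ),
       ∀ (M : DobrushinDomain), (∀ t : ℝ, dist (M.boundary t) (D.boundary t) ≤ η) →
         dist (M.pt 0) (D.pt 0) ≤ η → dist (M.pt 1) (D.pt 1) ≤ η →
         ∀ μ ν : Measure (CurveClass ℂ), IsSLELaw ((8 : ℝ≥0) / 3) M μ → IsSLELaw ((8 : ℝ≥0) / 3) D ν →
           |∫ x, f x ∂μ - ∫ x, f x ∂ν| ≤ ε) →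
    ∀ (D : DobrushinDomain) (a b : ℝ → HexVertex), IsEmbEndpointApprox hexGraph hexCenter D a b →
      ∀ (ν : Measure (CurveClass ℂ)), IsSLELaw ((8 : ℝ≥0) / 3) D ν →
      ∀ (f : CurveClass ℂ →ᵇ ℝ) (ε : ℝ), 0 < ε →
        ∃ R₀ > (0 : ℝ), ∀ R ∈ Set.Ioc (0 : ℝ) R₀, ∀ ρ > (0 : ℝ), ∀ N : ℕ,
          ∀ (δ : ℕ → ℝ) (S T : ℕ → ℕ → Set HexVertex) (n n' : ℕ → ℕ) (q q' : ℕ → HexVertex),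
            Tendsto δ atTop (𝓝[>] 0) →
            (∀ k, TameNestedFamily (δ k) R N (a (δ k)) (S k) ∧
              TameNestedFamily (δ k) R N (b (δ k)) (T k) ∧
              (((∀ i, ExteriorAnchored D.carrier (δ k) (S k i) (a (δ k))) ∧
          (∀ i, ExteriorAnchored D.carrier (δ k) (T k i) (b (δ k))) ∧
          (∀ (i : ℕ) (p q : HexVertex), HasCleanWindow D.carrier (δ k) ρ (S k i) p q →
            rowOf 0 q = rowOf 0 p + 1 ∧
              ∀ x : HexVertex, ((δ k : ℝ) : ℂ) * hexCenter x ∈ ball (((δ k : ℝ) : ℂ) * hexCenter q) ρ →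
                (x ∈ S k i ↔ rowOf 0 x ≤ rowOf 0 p)) ∧
          (∀ (i : ℕ) (p q : HexVertex), HasCleanWindow D.carrier (δ k) ρ (T k i) p q →
            rowOf 0 q = rowOf 0 p + 1 ∧
              ∀ x : HexVertex, ((δ k : ℝ) : ℂ) * hexCenter x ∈ ball (((δ k : ℝ) : ℂ) * hexCenter q) ρ →
                (x ∈ T k i ↔ rowOf 0 x ≤ rowOf 0 p))) ∧
          (∀ (i : ℕ) (p q : HexVertex), HasCleanWindow D.carrier (δ k) ρ (S k i) p q →
            ∃ K : Set ℂ, IsCompact K ∧ IsConnected K ∧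
              ((δ k : ℝ) : ℂ) * hexCenter q - ((ρ / 2 : ℝ) : ℂ) * Complex.I ∈ K ∧ ((δ k : ℝ) : ℂ) * hexCenter (a (δ k)) ∈ K ∧
              ∀ v : HexVertex, Metric.infDist (((δ k : ℝ) : ℂ) * hexCenter v) K ≤ ρ / 4 → v ∈ S k i) ∧
          (∀ (i : ℕ) (p q : HexVertex), HasCleanWindow D.carrier (δ k) ρ (T k i) p q →
            ∃ K : Set ℂ, IsCompact K ∧ IsConnected K ∧
              ((δ k : ℝ) : ℂ) * hexCenter q - ((ρ / 2 : ℝ) : ℂ) * Complex.I ∈ K ∧ ((δ k : ℝ) : ℂ) * hexCenter (b (δ k)) ∈ K ∧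
              ∀ v : HexVertex, Metric.infDist (((δ k : ℝ) : ℂ) * hexCenter v) K ≤ ρ / 4 → v ∈ T k i))) →
            (∀ k, ∃ (γ : HexDomainSAW D.carrier (δ k) (a (δ k)) (b (δ k))) (m : ℕ) (p : HexVertex)
                (m' : ℕ) (p' : HexVertex),
              IsFirstGoodGateN D.carrier (δ k) ρ R (S k) (a (δ k)) γ.walk.support (n k) m p (q k) ∧
              IsFirstGoodGateN D.carrier (δ k) ρ R (T k) (b (δ k)) γ.walk.support.reverse
                (n' k) m' p' (q' k) ∧
              WideLink D.carrier (δ k) ρ (S k (n k) ∪ T k (n' k)) (q k) (q' k)) →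
            (∀ k, IsProbabilityMeasure
              (carvedLaw D.carrier (δ k) (S k (n k) ∪ T k (n' k)) (q k) (q' k))) →
            (∀ η > (0 : ℝ), ∃ 𝒦 : Set (CurveClass ℂ), IsCompact 𝒦 ∧ ∀ᶠ k in atTop,
              carvedLaw D.carrier (δ k) (S k (n k) ∪ T k (n' k)) (q k) (q' k)
                {ξ | ξ.curve ∉ 𝒦} ≤ ENNReal.ofReal η) →
            (∀ ε' > (0 : ℝ), ∀ η > (0 : ℝ), ∃ θ > (0 : ℝ), ∀ᶠ k in atTop,
              carvedLaw D.carrier (δ k) (S k (n k) ∪ T k (n' k)) (q k) (q' k)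
                {ξ | ξ.curve ∉ CurveClass.modulusClass ε' θ} ≤ ENNReal.ofReal η) →
            ∀ᶠ k in atTop,
              |(∫ ξ, f ξ.curve ∂(carvedLaw D.carrier (δ k) (S k (n k) ∪ T k (n' k)) (q k) (q' k))) -
                  ∫ x, f x ∂ν| ≤ ε := by
  intro hAtom hT2a hSLC D a b hab ν hν f ε hε
  obtain ⟨ηD, hηD, hcont⟩ := hSLC D f (ε / 2) (half_pos hε)
  obtain ⟨R₀, hR₀, hR⟩ := hAtom D a b hab ηD hηD
  refine ⟨R₀, hR₀, ?_⟩
  intro R hRmem ρ hρ N δ S T n n' q q' hδ hfam hgates hprob htight hmod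
  by_contra hnot
  obtain ⟨φ, hφ, hbad⟩ := exists_strictMono_forall_of_not_eventually hnot
  have hf1 : 0 < ‖f‖ + 1 := by positivity
  set ε' : ℝ := min (1 / 2) (ε / (16 * (‖f‖ + 1))) with hε'
  have hε'pos : 0 < ε' := lt_min (by norm_num) (by positivity)
  have hε'lt : ε' < 1 := (min_le_left _ _).trans_lt (by norm_num)
  have hε'le : 2 * ‖f‖ * ε' ≤ ε / 8 := by
    refine (mul_le_mul_of_nonneg_left (min_le_right _ _) (by positivity)).trans ?_
    rw [mul_div_assoc', div_le_div_iff₀ (by positivity) (by norm_num)]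
    nlinarith [norm_nonneg f, hε.le]
  obtain ⟨ψ, M, τ, ρ', Λ', m, a', b', x, Λ'', pu, pv, hψ, hbd, hpt0, hpt1, hflat, hadm, hexh, ha',
    hb', hτ, hlink, hsq⟩ := hR R hRmem ρ hρ N δ S T n n' q q' hδ hfam hgates ε' hε'pos φ hφ
  have hktop : Tendsto (fun j => φ (ψ j)) atTop atTop := hφ.tendsto_atTop.comp hψ.tendsto_atTop
  have hs : Tendsto (fun j => δ (φ (ψ j))) atTop (𝓝[>] 0) := hδ.comp hktop
  have hspos : ∀ᶠ j in atTop, 0 < δ (φ (ψ j)) := hs.eventually eventually_mem_nhdsWithin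
  have hadm_j := hs.eventually hadm
  have hne_j : ∀ᶠ j in atTop, Nonempty (HexMidEdgeSAW (Λ' (δ (φ (ψ j)))) (a' (δ (φ (ψ j))))
      (b' (δ (φ (ψ j))))) := hadm_j.mono fun j h => h.2.2.2.1
  set νp : ℕ → Measure (CurveClass ℂ) := fun j =>
    (∑ γ : HexMidEdgeSAW (Λ' (δ (φ (ψ j)))) (a' (δ (φ (ψ j)))) (b' (δ (φ (ψ j)))),
      ENNReal.ofReal (hexCriticalFugacity ^ γ.length /
        (∑ γ' : HexMidEdgeSAW (Λ' (δ (φ (ψ j)))) (a' (δ (φ (ψ j)))) (b' (δ (φ (ψ j)))),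
          hexCriticalFugacity ^ γ'.length)) •
        Measure.dirac (CurveClass.mk ⟨polyline (γ.verts.map fun w => ((δ (φ (ψ j)) : ℝ) : ℂ) *
          hexCenter w)⟩) : Measure (CurveClass ℂ)) with hνp
  have hP_j : ∀ᶠ j in atTop, IsProbabilityMeasure (νp j) :=
    hne_j.mono fun j h => isProbabilityMeasure_dcsLaw h
  set w : ℕ → ℂ := fun j => ((δ (φ (ψ j)) : ℝ) : ℂ) * triEmbed (x j) with hw
  -- THE PER-INDEX TRANSPORT FACTS (positive mesh, nonempty pinned family)
  have hcore : ∀ j, 0 < δ (φ (ψ j)) →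
      Nonempty (HexMidEdgeSAW (Λ' (δ (φ (ψ j)))) (a' (δ (φ (ψ j)))) (b' (δ (φ (ψ j))))) →
      (∀ g : CurveClass ℂ →ᵇ ℝ,
        |(∫ ξ, g ξ.curve ∂(carvedLaw D.carrier (δ (φ (ψ j)))
            (S (φ (ψ j)) (n (φ (ψ j))) ∪ T (φ (ψ j)) (n' (φ (ψ j)))) (q (φ (ψ j))) (q' (φ (ψ j))))) -
          ∫ c, g (CurveClass.map ⟨Homeomorph.addRight (w j), (Homeomorph.addRight (w j)).continuous⟩ c)
            ∂νp j| ≤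
        2 * ‖g‖ * (1 - (carvedLaw D.carrier (δ (φ (ψ j)))
            (S (φ (ψ j)) (n (φ (ψ j))) ∪ T (φ (ψ j)) (n' (φ (ψ j)))) (q (φ (ψ j))) (q' (φ (ψ j)))
            {ξ | ∀ w ∈ ξ.walk.support, w ∈ Λ'' j}).toReal)) ∧
      (∀ (𝒞 𝒞' : Set (CurveClass ℂ)),
        (∀ c, CurveClass.map ⟨Homeomorph.addRight (w j), (Homeomorph.addRight (w j)).continuous⟩ c ∈ 𝒞 →
          c ∈ 𝒞') →
        ∀ η : ℝ, 0 ≤ η →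
        carvedLaw D.carrier (δ (φ (ψ j))) (S (φ (ψ j)) (n (φ (ψ j))) ∪ T (φ (ψ j)) (n' (φ (ψ j))))
            (q (φ (ψ j))) (q' (φ (ψ j))) {ξ | ξ.curve ∉ 𝒞} ≤
          ENNReal.ofReal η * carvedLaw D.carrier (δ (φ (ψ j)))
            (S (φ (ψ j)) (n (φ (ψ j))) ∪ T (φ (ψ j)) (n' (φ (ψ j)))) (q (φ (ψ j))) (q' (φ (ψ j)))
            {ξ | ∀ w ∈ ξ.walk.support, w ∈ Λ'' j} →
        (∑ γ : HexMidEdgeSAW (Λ' (δ (φ (ψ j)))) (a' (δ (φ (ψ j)))) (b' (δ (φ (ψ j)))),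
            if CurveClass.mk ⟨polyline (γ.verts.map fun w => ((δ (φ (ψ j)) : ℝ) : ℂ) * hexCenter w)⟩ ∉ 𝒞'
            then hexCriticalFugacity ^ γ.length else 0) ≤
          η * ∑ γ : HexMidEdgeSAW (Λ' (δ (φ (ψ j)))) (a' (δ (φ (ψ j)))) (b' (δ (φ (ψ j)))),
            hexCriticalFugacity ^ γ.length) := by
    intro j hδj hnej
    obtain ⟨hrel, hΛS, hedge, hqmem, hpu, hpv, hadj, hne, hmapa, hmapb⟩ := hlink j
    haveI : Finite (HexDomainSAW D.carrier (δ (φ (ψ j))) (q (φ (ψ j))) (q' (φ (ψ j)))) :=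
      finite_hexDomainSAW D.isBounded hδj.ne' _ _
    haveI := Fintype.ofFinite (HexDomainSAW D.carrier (δ (φ (ψ j))) (q (φ (ψ j))) (q' (φ (ψ j))))
    haveI := hprob (φ (ψ j))
    exact ⟨fun g => core_transport hΛS hedge hqmem hpu hpv hadj hne hrel hmapa hmapb hnej g,
      fun 𝒞 𝒞' h𝒞 η hη h => core_transport_event hΛS hedge hqmem hpu hpv hadj hne hrel hmapa hmapb
        𝒞 𝒞' h𝒞 hη h⟩
  -- (i) the carved integrals are close to the translated pinned integrals, eventually
  have hI : ∀ᶠ j in atTop,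
      |(∫ ξ, f ξ.curve ∂(carvedLaw D.carrier (δ (φ (ψ j)))
          (S (φ (ψ j)) (n (φ (ψ j))) ∪ T (φ (ψ j)) (n' (φ (ψ j)))) (q (φ (ψ j))) (q' (φ (ψ j))))) -
        ∫ c, f (CurveClass.map ⟨Homeomorph.addRight (w j), (Homeomorph.addRight (w j)).continuous⟩ c)
          ∂νp j| ≤ 2 * ‖f‖ * ε' := by
    filter_upwards [hspos, hne_j, hsq] with j hδj hnej hsqj
    refine ((hcore j hδj hnej).1 f).trans ?_
    exact mul_le_mul_of_nonneg_left (by linarith) (by positivity)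
  -- (ii) the pinned laws are eventually uniformly tight
  have htight_j : ∀ η : ℝ, 0 < η → ∃ K : Set (CurveClass ℂ), IsCompact K ∧ ∀ᶠ j in atTop,
      νp j Kᶜ ≤ ENNReal.ofReal η := by
    intro η hη
    have hη' : 0 < η * (1 - ε') := by
      exact mul_pos hη (by linarith)
    obtain ⟨𝒦, h𝒦, hev⟩ := htight (η * (1 - ε')) hη'
    set F : CurveClass ℂ × ℂ → CurveClass ℂ := fun p =>
      CurveClass.map ⟨Homeomorph.addRight p.2, (Homeomorph.addRight p.2).continuous⟩ p.1 with hF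
    refine ⟨F '' (𝒦 ×ˢ closedBall (-τ) 1),
      (h𝒦.prod (isCompact_closedBall _ _)).image continuous_translate_uncurry, ?_⟩
    have hwev : ∀ᶠ j in atTop, dist (w j) τ < 1 := Metric.tendsto_nhds.1 hτ 1 one_pos
    have hevk : ∀ᶠ j in atTop, carvedLaw D.carrier (δ (φ (ψ j)))
        (S (φ (ψ j)) (n (φ (ψ j))) ∪ T (φ (ψ j)) (n' (φ (ψ j)))) (q (φ (ψ j))) (q' (φ (ψ j)))
        {ξ | ξ.curve ∉ 𝒦} ≤ ENNReal.ofReal (η * (1 - ε')) := hktop.eventually hev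
    filter_upwards [hspos, hne_j, hsq, hevk, hwev] with j hδj hnej hsqj hevj hwj
    have hZ := dcsMass_pos (Λ := Λ' (δ (φ (ψ j)))) (a := a' (δ (φ (ψ j)))) (b := b' (δ (φ (ψ j)))) hnej
    have key := (hcore j hδj hnej).2 {ξ | ξ ∈ 𝒦} (F '' (𝒦 ×ˢ closedBall (-τ) 1)) (fun c hc => ?_) η hη.le ?_
    · rw [dcsLaw_apply (IsCompact.image (h𝒦.prod (isCompact_closedBall _ _))
        continuous_translate_uncurry).isClosed.isOpen_compl.measurableSet]
      refine ENNReal.ofReal_le_ofReal ((div_le_iff₀ hZ).2 ?_)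
      refine le_trans (le_of_eq (Finset.sum_congr rfl fun γ _ => ?_)) key
      simp only [Set.mem_compl_iff, hF]
    · -- `c + w j ∈ 𝒦` forces `c ∈ F(𝒦 × B̄(-τ, 1))`
      refine ⟨(CurveClass.map ⟨Homeomorph.addRight (w j), (Homeomorph.addRight (w j)).continuous⟩ c,
        -w j), ⟨hc, ?_⟩, ?_⟩
      · rw [mem_closedBall, dist_neg_neg]; exact hwj.le
      · simp only [hF]
        rw [translate_translate, add_neg_cancel, translate_zero]
    · exact le_mul_of_squeeze hη.le (measure_ne_top _ _) hevj hsqj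
  -- (iv) weak subsequential limits of the pinned laws are SLE(8/3) in `M`; translate, compare
  have hident : ∀ (χ : ℕ → ℕ) (μ : Measure (CurveClass ℂ)), StrictMono χ → IsProbabilityMeasure μ →
      (∀ g : CurveClass ℂ →ᵇ ℝ, Tendsto (fun i => ∫ c, g c ∂νp (χ i)) atTop (𝓝 (∫ c, g c ∂μ))) →
      |(∫ c, f (CurveClass.map ⟨Homeomorph.addRight τ, (Homeomorph.addRight τ).continuous⟩ c) ∂μ) -
        ∫ x, f x ∂ν| ≤ ε / 2 := by
    intro χ μ hχ hμ hconv
    haveI := hμ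
    have hχtop : Tendsto χ atTop atTop := hχ.tendsto_atTop
    have hsχ : Tendsto (fun i => δ (φ (ψ (χ i)))) atTop (𝓝[>] 0) := hs.comp hχtop
    have hratio : ∀ g : CurveClass ℂ →ᵇ ℝ, Tendsto (fun i =>
        (∑ γ : HexMidEdgeSAW (Λ' (δ (φ (ψ (χ i))))) (a' (δ (φ (ψ (χ i))))) (b' (δ (φ (ψ (χ i))))),
            hexCriticalFugacity ^ γ.length *
              g (CurveClass.mk ⟨polyline (γ.verts.map fun v =>
                ((δ (φ (ψ (χ i))) : ℝ) : ℂ) * hexCenter v)⟩)) /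
          (∑ γ : HexMidEdgeSAW (Λ' (δ (φ (ψ (χ i))))) (a' (δ (φ (ψ (χ i))))) (b' (δ (φ (ψ (χ i))))),
            hexCriticalFugacity ^ γ.length)) atTop (𝓝 (∫ c, g c ∂μ)) := by
      intro g
      refine (hconv g).congr' ?_
      filter_upwards [hχtop.eventually hne_j] with i hnei
      exact integral_dcsLaw hnei g
    have hmodχ : ∀ ε₁ η₁ : ℝ, 0 < ε₁ → 0 < η₁ → ∃ θ : ℝ, 0 < θ ∧ ∀ᶠ i in atTop,
        (∑ γ : HexMidEdgeSAW (Λ' (δ (φ (ψ (χ i))))) (a' (δ (φ (ψ (χ i))))) (b' (δ (φ (ψ (χ i))))),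
            if CurveClass.mk ⟨polyline (γ.verts.map fun v => ((δ (φ (ψ (χ i))) : ℝ) : ℂ) * hexCenter v)⟩ ∉
                CurveClass.modulusClass ε₁ θ
            then hexCriticalFugacity ^ γ.length else 0) ≤
          η₁ * ∑ γ : HexMidEdgeSAW (Λ' (δ (φ (ψ (χ i))))) (a' (δ (φ (ψ (χ i))))) (b' (δ (φ (ψ (χ i))))),
            hexCriticalFugacity ^ γ.length := by
      intro ε₁ η₁ hε₁ hη₁
      have hη₁' : 0 < η₁ * (1 - ε') := by
        exact mul_pos hη₁ (by linarith)
      obtain ⟨θ, hθ, hev⟩ := hmod ε₁ hε₁ (η₁ * (1 - ε')) hη₁'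
      refine ⟨θ, hθ, ?_⟩
      have hevχ : ∀ᶠ i in atTop, carvedLaw D.carrier (δ (φ (ψ (χ i))))
          (S (φ (ψ (χ i))) (n (φ (ψ (χ i)))) ∪ T (φ (ψ (χ i))) (n' (φ (ψ (χ i)))))
          (q (φ (ψ (χ i)))) (q' (φ (ψ (χ i))))
          {ξ | ξ.curve ∉ CurveClass.modulusClass ε₁ θ} ≤ ENNReal.ofReal (η₁ * (1 - ε')) :=
        (hktop.comp hχtop).eventually hev
      filter_upwards [hχtop.eventually hspos, hχtop.eventually hne_j, hχtop.eventually hsq, hevχ]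
        with i hδi hnei hsqi hevi
      refine (hcore (χ i) hδi hnei).2 (CurveClass.modulusClass ε₁ θ) (CurveClass.modulusClass ε₁ θ)
        (fun c hc => (translate_mem_modulusClass_iff _ ε₁ θ c).1 hc) η₁ hη₁.le ?_
      exact le_mul_of_squeeze hη₁.le (measure_ne_top _ _) hevi hsqi
    have hSLE : IsSLELaw ((8 : ℝ≥0) / 3) M μ :=
      hT2a M ρ' Λ' m a' b' hflat hadm hexh ha' hb' μ (fun i => δ (φ (ψ (χ i)))) hμ hsχ hratio hmodχ
    exact stub_carvedReduction_continuityStep D M τ ηD (ε / 2) f μ ν hcont hbd hpt0 hpt1 hSLE hν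
  obtain ⟨j, -, hj⟩ := exists_close_of_weakLimits νp
    (fun j => ∫ ξ, f ξ.curve ∂(carvedLaw D.carrier (δ (φ (ψ j)))
      (S (φ (ψ j)) (n (φ (ψ j))) ∪ T (φ (ψ j)) (n' (φ (ψ j)))) (q (φ (ψ j))) (q' (φ (ψ j)))))
    (∫ x, f x ∂ν) w τ f (2 * ‖f‖ * ε') (ε / 2) (ε / 8) (by positivity) hP_j htight_j hI hτ hident 0
  exact hbad (ψ j) (by linarith)

end Summit.CriticalPhenomena.SAWScalingLimit.Theorems.ObservableToSLE.TypeLadder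

end
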